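import Summits.QuantumFields.QCD.Theses.HeatSlicedQuarks
import Summits.QuantumFields.QCD.Theses.HeavyThresholdYMBridge
import Literature.Barriers.QuantumFields.PerturbativeInvisibility

/-!
# Sketch 2 (crux-ideate g2 k1, crux stmt-QuantumFields-8892) — card `interval-of-couplings`

The β-direction of the handover in CLOSED FORM. `ClosedFormYMRate`: beyond some `β₀`, Wilson `SU(3)`
lattice Yang–Mills clusters on every torus of physical size `≥ R` at a rate `c · am(β)` in lattice
units, where `am(β) = asymptoticScalingMass 1 b₀ b₁ g(β)` (`g² = 2/β`, tree normalisation) is the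
two-loop asymptotic-scaling mass law of the barrier file `PerturbativeInvisibility` — i.e.
`liminf_β m_lat(β)/a_AF(β) > 0` with per-pair constants uniform in `β`. `DecoupledScaleSweeps`: the
decoupled pure-gauge scale of a mass tuple sweeps a whole half-line as the tuple ranges above any
threshold (one-loop matching shape of `CouplingMatching` 8797), which is why an INTERVAL of couplings
is consumed by any same-lattice handover. `ClosedFormFeedsHandover`: the closed form implies the
sibling route's typed β-universality item `YMLatticeGapAlongAFSequences` (stmt-QuantumFields-8796).
All three are `Prop`s that elaborate; none is proved here.
-/

namespace Summit.QuantumFields.QCD.Cruxes.RobustYangMillsHandover.IdeaSketchG2K1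

open Filter

/-- The two-loop asymptotic-scaling mass law of pure `SU(3)` gauge theory as a function of the TREE's
inverse coupling `β = 2/g₀²`: `am(β) = exp(−1/(2b₀g²))·(b₀g²)^{−b₁/(2b₀²)}` with `g² = 2/β`,
`b₀ = betaCoeff₀ 0`, `b₁ = betaCoeff₁ 0` (constant `C = 1`: the unit is absorbed in `c`, `R`). -/
noncomputable def amOfBeta (β : ℝ) : ℝ :=
  Literature.Barriers.QuantumFields.asymptoticScalingMass 1
    (Literature.MathematicalPhysics.QuantumFieldTheory.betaCoeff₀ 0)
    (Literature.MathematicalPhysics.QuantumFieldTheory.betaCoeff₁ 0) (Real.sqrt (2 / β))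

/-- **Closed form of the β-direction.** There are `c > 0`, a physical-size threshold `R` and `β₀`
such that for every pair of gauge-invariant local lattice observables there is `C` with: for all
`β ≥ β₀`, on every torus of side `2S+1` with `S · am(β) ≥ R`, and all time separations `n ≤ S`,
`|⟨A · τ_n B⟩ − ⟨A⟩⟨B⟩| ≤ C exp(−c · am(β) · n)` — the lattice glueball mass obeys asymptotic scaling
FROM BELOW, uniformly in the volume, along the whole approach to the continuum (not along one
sequence). -/
def ClosedFormYMRate : Prop :=
  ∃ c R β₀ : ℝ, 0 < c ∧
    ∀ A B : Literature.MathematicalPhysics.QuantumFieldTheory.YMSpecies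
        (Matrix.specialUnitaryGroup (Fin 3) ℂ),
      ∃ C : ℝ, ∀ β : ℝ, β₀ ≤ β → ∀ S : ℕ, R ≤ (S : ℝ) * amOfBeta β → ∀ n : ℕ, n ≤ S →
        |Literature.MathematicalPhysics.QuantumFieldTheory.latticeConnectedCorr
            (Literature.MathematicalPhysics.QuantumLattice.fundamentalRep (Fin 3)) β (2 * S + 1) A.F B.F n|
          ≤ C * Real.exp (-(c * amOfBeta β * n))

/-- **The decoupled scale sweeps a half-line.** One-loop matching shape (`CouplingMatching` 8797):
for `N_f` flavours of RGI masses `m_f` decoupling from an `N_f`-flavour theory of scale `Λ`, the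
pure-gauge scale left behind is `Λ′(m) = Λ^{b₀(N_f)/b₀(0)} · ∏_f m_f^{(b₀(0) − b₀(N_f))/(N_f · b₀(0))}`;
for every `Λ > 0`, `N_f ≥ 1` and every threshold `M₀ ≥ 0`, every value above `Λ′(M₀+1, …, M₀+1)` is
attained by some tuple with all `m_f > M₀`. Hence a mass-INDEPENDENT regularisation serving all tuples
above `M₀` hands over to Wilson Yang–Mills at a CONTINUUM of physical scales, i.e. at every large
bare coupling on each of its lattices. (Pure real analysis: continuity + unboundedness of a product of
positive powers.) -/
def DecoupledScaleSweeps : Prop :=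
  ∀ (Nf : ℕ) (Λ M₀ : ℝ), 1 ≤ Nf → 0 < Λ → 0 ≤ M₀ →
    let b0 := Literature.MathematicalPhysics.QuantumFieldTheory.betaCoeff₀ 0
    let bN := Literature.MathematicalPhysics.QuantumFieldTheory.betaCoeff₀ Nf
    let Λ' : (Fin Nf → ℝ) → ℝ := fun m =>
      Λ ^ (bN / b0) * ∏ f, (m f) ^ ((b0 - bN) / ((Nf : ℝ) * b0))
    ∀ y : ℝ, Λ' (fun _ => M₀ + 1) < y → ∃ m : Fin Nf → ℝ, (∀ f, M₀ < m f) ∧ Λ' m = y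

/-- **The closed form feeds every handover line**: it implies the sibling route's typed
β-universality item (stmt-QuantumFields-8796, `YMLatticeGapAlongAFSequences`: gap along EVERY
N_f = 0 asymptotically scaling coupling sequence on any spacings with `a_k L_k → ∞`), because along
such a sequence `am(β_k) ≍ a_k Λ′` (two-loop inversion of `afBeta`, the `o(1)` in `β` costing a factor
`→ 1`) and `S ≥ L_k` gives `S · am(β_k) → ∞ ≥ R` eventually. Real analysis, provable now (M). -/
def ClosedFormFeedsHandover : Prop :=
  ClosedFormYMRate → Summit.QuantumFields.QCD.Theses.HeavyThresholdYMBridge.YMLatticeGapAlongAFSequences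

end Summit.QuantumFields.QCD.Cruxes.RobustYangMillsHandover.IdeaSketchG2K1
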